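import Literature.AnabelianGeometry.AbsoluteAnabelian.AbsTopII.DPSCDataOfOuterAction
import Literature.AnabelianGeometry.AbsoluteAnabelian.AbsTopII.Prop13vCoveringReduction

/-!
# [AbsTopII] Prop 1.3 (v) over a PSC-presented DPSC datum, «(iv) at open subgroups» read from (iv) at
# the finite étale coverings

S. Mochizuki, *Topics in Absolute Anabelian Geometry II* [AbsTopII] (bib `MochizukiAbsTopII2013`; kurims
manuscript `paper:url-585b8d0ad0d9`), §1 Def 1.2 (ii) p. 10, Remark 1.2.1 pp. 10–11, Prop 1.3 (v) p. 12
and its proof p. 16; [CombGC] (bib `MochizukiCombGC2007`) Prop 1.2 (i)(ii) p. 8, Def 1.4 (i) p. 10.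

PROOF-ONLY companion (no definitions) joining abc-iut-w5-d226's bridge `AbsTopII/DPSCDataOfSemiGraphGraphic.lean`
(a DPSC datum `X` PRESENTED by a layer-L3 PSC datum `G : PSCDatum ↥X.PiG`: hypotheses `hV`, `hgr`; closer
`DPSCData.prop13v_of_psc` for F-0278 with the verbatim input `hL` = row P13/I-L "(iv) at open subgroups")
with `AbsTopII/Prop13vCoveringReduction.lean` (row P13/I-L DERIVED from the "in particular" clause of
Prop 1.3 (iv) applied to the DPSC data of the finite étale coverings of Remark 1.2.1, `Π_v` closed and `I_v`
torsion-free): at PSC-presented data `Π_v` is closed by [CombGC] Def 1.1 (ii) (`isClosed_vertSub_of_psc`)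
and graphicity comes from [CombGC] Def 1.4 (i) (`graphic_vertSub_of_psc`), so the closers below carry, in
place of `hL`, only: the typed rows `Prop13iii` (F-0275) / `Prop13iv'` BY NAME, "`I_v` torsion-free"
(⟸ `I_v ≅ Ẑ^Σ`, Prop 1.3 (iii)), and (iv) for the coverings (hypothesis `hcov`, spelled as in
`Prop13vCoveringReduction.lean`: for every open normal `N ⊆ Π_H`, `U := N ∩ Π_𝔾`, some finite-index
inertia part `J ⊆ N ∩ Π_I`, and the vertices `ṽ_1 = [Π_v·U]`, `ṽ_δ = [δ·Π_v·U]` (`δ ∈ Π_𝔾`) of the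
covering graph over `v`: "`I_{ṽ_1} ∩ I_{ṽ_δ} ≠ {1}` implies `ṽ_1 = ṽ_δ`", i.e. `δ ∈ Π_v·U`).

* `DPSCData.inputL_of_psc_of_coverings` — row P13/I-L at PSC-presented data;
* `DPSCData.prop13v_of_psc_of_coverings` — **F-0278 `DPSCData.Prop13v`** at PSC-presented data modulo
  [CombGC] Prop 1.2 (i)(ii) for `G`, graphicity, `Prop13iii`, `Prop13iv'`, (iv) at the coverings, `I_v`
  torsion-free and infinite;
* `DPSCData.prop13v_of_pscOrigin_of_coverings` — the same modulo the FACT-LIST rows F-0438 / F-0459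
  ([CombGC] Prop 1.2 (ii)/(i) for data of PSC-type);
* `DPSCData.prop13v_ofEmbedding_of_coverings`, `DPSCData.prop13v_ofOuterAction_of_coverings` — the same
  for the EMBEDDED datum (`DPSCData.ofEmbedding`, `AbsTopII/DPSCDataOfEmbedding.lean`) and for the
  CONSTRUCTED DPSC-extension `Π_𝒢 ⋊^out_θ J` of the construction data (`DPSCData.ofOuterAction`,
  `AbsTopII/DPSCDataOfOuterAction.lean`, Def 1.2 (ii)), replacing the `hL` of `prop13v_ofEmbedding` /
  `prop13v_ofOuterAction`.
HONEST FRAMING: classical group theory over two typed interfaces; (iv) for the coverings is a geometric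
input and stays a hypothesis; typed ≠ proved; nothing here bears on [IUTchIII] Cor 3.12 or takes a side on
any author.
-/

open scoped Pointwise

namespace Literature.AnabelianGeometry.AbsoluteAnabelian

open Literature.AnabelianGeometry.SemiGraphs

universe u

namespace DPSCData

variable (X : DPSCData.{u}) (G : PSCDatum ↥X.PiG) (eV : X.Vert ≃ G.graph.V)

/-- **Row P13/I-L at a PSC-presented DPSC datum** — "if, for `γ ∈ Π_H`, `I_v ∩ (γ·I_v·γ⁻¹) ≠ {1}`, then
`Π_v = γ·Π_v·γ⁻¹`" (proof of Prop 1.3 (v) p. 16) — from: graphicity of the conjugation action ([CombGC]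
Def 1.4 (i), `hgr`), the "in particular" clause of (iv) at `Π_𝔾`-scope for `𝔾` (`hiv`) AND for its finite
étale coverings (`hcov`, Remark 1.2.1), `I_v ∩ Π_𝔾 = {1}` ((iii), `h3`) and `I_v` torsion-free (`htf`);
`Π_v` is closed by [CombGC] Def 1.1 (ii). [cite: MochizukiAbsTopII2013, Prop 1.3 (v) p.16]
[cite: MochizukiCombGC2007, Def 1.4(i) p.10] -/
theorem inputL_of_psc_of_coverings
    (hV : ∀ v, ∃ δ : ConjAct ↥X.PiG, (X.vertSub v).subgroupOf X.PiG = δ • G.vertGp (eV v))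
    (hgr : ∀ h : X.PiH, ∃ α : ↥X.PiG ≃ₜ* ↥X.PiG,
      (∀ x : ↥X.PiG, ((α x : ↥X.PiG) : X.PiH) = h * x * h⁻¹) ∧ G.IsGraphic G α)
    (hiv : ∀ (v v' : X.Vert) (γ : X.PiH), γ ∈ X.PiG →
      X.Iv v ⊓ MulAut.conj γ • X.Iv v' ≠ ⊥ → v = v')
    (h3 : ∀ v : X.Vert, X.Iv v ⊓ X.PiG = ⊥)
    (htf : ∀ (v : X.Vert), ∀ x ∈ X.Iv v, IsOfFinOrder x → x = 1)
    (hcov : ∀ N : Subgroup X.PiH, N.Normal → IsOpen (N : Set X.PiH) →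
      ∃ J : Subgroup X.PiH, J ≤ N ⊓ X.PiI ∧ J.relIndex X.PiI ≠ 0 ∧
        ∀ (v : X.Vert), ∀ δ ∈ X.PiG,
          Subgroup.centralizer ((X.vertSub v ⊓ (N ⊓ X.PiG) : Subgroup X.PiH) : Set X.PiH) ⊓ J ⊓
              Subgroup.centralizer
                ((MulAut.conj δ • X.vertSub v ⊓ (N ⊓ X.PiG) : Subgroup X.PiH) : Set X.PiH) ≠ ⊥ →
            δ ∈ X.vertSub v ⊔ (N ⊓ X.PiG)) :
    ∀ (v : X.Vert) (g : X.PiH), X.Iv v ⊓ MulAut.conj g • X.Iv v ≠ ⊥ →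
      MulAut.conj g • X.vertSub v = X.vertSub v :=
  X.inputL_of_coverings (X.graphic_vertSub_of_psc G eV hV hgr) hiv h3
    (X.isClosed_vertSub_of_psc G eV hV) htf hcov

/-- **[AbsTopII] Prop 1.3 (v) (outer clauses) as typed** (`DPSCData.Prop13v`, F-0278) for DPSC data
presented by a PSC datum, with the input "(iv) at open subgroups" of `prop13v_of_psc` READ FROM (iv) at
the finite étale coverings (Remark 1.2.1): `Π_𝔾`-inputs from layer L3 ([CombGC] Prop 1.2 (i)/(ii):
`hDetV`, `hCT`) + graphicity (`hgr`); the typed rows `Prop13iii` (F-0275), `Prop13iv'` BY NAME; (iv) for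
the coverings (`hcov`); "`I_v` torsion-free" and "`I_v` infinite" (Prop 1.3 (iii), `I_v ≅ Ẑ^Σ`).
[cite: MochizukiAbsTopII2013, Prop 1.3 (v) p.12] -/
theorem prop13v_of_psc_of_coverings
    (hV : ∀ v, ∃ δ : ConjAct ↥X.PiG, (X.vertSub v).subgroupOf X.PiG = δ • G.vertGp (eV v))
    (hCT : G.VerticialEdgeLikeCommensurablyTerminal) (hDetV : G.VerticialOpenInterDeterminesVertex)
    (hgr : ∀ h : X.PiH, ∃ α : ↥X.PiG ≃ₜ* ↥X.PiG,
      (∀ x : ↥X.PiG, ((α x : ↥X.PiG) : X.PiH) = h * x * h⁻¹) ∧ G.IsGraphic G α)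
    (hiii : X.Prop13iii) (hiv' : X.Prop13iv')
    (htf : ∀ (v : X.Vert), ∀ x ∈ X.Iv v, IsOfFinOrder x → x = 1)
    (hcov : ∀ N : Subgroup X.PiH, N.Normal → IsOpen (N : Set X.PiH) →
      ∃ J : Subgroup X.PiH, J ≤ N ⊓ X.PiI ∧ J.relIndex X.PiI ≠ 0 ∧
        ∀ (v : X.Vert), ∀ δ ∈ X.PiG,
          Subgroup.centralizer ((X.vertSub v ⊓ (N ⊓ X.PiG) : Subgroup X.PiH) : Set X.PiH) ⊓ J ⊓
              Subgroup.centralizer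
                ((MulAut.conj δ • X.vertSub v ⊓ (N ⊓ X.PiG) : Subgroup X.PiH) : Set X.PiH) ≠ ⊥ →
            δ ∈ X.vertSub v ⊔ (N ⊓ X.PiG))
    (hinf : ∀ v : X.Vert, Infinite ↥(X.Iv v)) : X.Prop13v :=
  X.prop13v_of_psc G eV hV hCT hDetV hgr
    (X.inputL_of_psc_of_coverings G eV hV hgr hiv'.2 (fun v => (hiii v).1) htf hcov) hinf

/-- **[AbsTopII] Prop 1.3 (v) (F-0278) modulo F-0438 + F-0459, graphicity, `Prop13iii`, `Prop13iv'`, (iv)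
at the finite étale coverings, "`I_v` torsion-free" and "`I_v` infinite"** — the `PSCOrigin` form of
`prop13v_of_psc_of_coverings`. [cite: MochizukiAbsTopII2013, Prop 1.3 (v) p.12]
[cite: MochizukiCombGC2007, Prop 1.2 p.8] -/
theorem prop13v_of_pscOrigin_of_coverings (Ω : PSCOrigin.{u}) (hΩ : Ω.IsOfPSCType G)
    (hF0438 : PSCDatum.CommensurableTerminalityHolds Ω)
    (hF0459 : PSCDatum.OpenInterDeterminesComponentHolds Ω)
    (hV : ∀ v, ∃ δ : ConjAct ↥X.PiG, (X.vertSub v).subgroupOf X.PiG = δ • G.vertGp (eV v))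
    (hgr : ∀ h : X.PiH, ∃ α : ↥X.PiG ≃ₜ* ↥X.PiG,
      (∀ x : ↥X.PiG, ((α x : ↥X.PiG) : X.PiH) = h * x * h⁻¹) ∧ G.IsGraphic G α)
    (hiii : X.Prop13iii) (hiv' : X.Prop13iv')
    (htf : ∀ (v : X.Vert), ∀ x ∈ X.Iv v, IsOfFinOrder x → x = 1)
    (hcov : ∀ N : Subgroup X.PiH, N.Normal → IsOpen (N : Set X.PiH) →
      ∃ J : Subgroup X.PiH, J ≤ N ⊓ X.PiI ∧ J.relIndex X.PiI ≠ 0 ∧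
        ∀ (v : X.Vert), ∀ δ ∈ X.PiG,
          Subgroup.centralizer ((X.vertSub v ⊓ (N ⊓ X.PiG) : Subgroup X.PiH) : Set X.PiH) ⊓ J ⊓
              Subgroup.centralizer
                ((MulAut.conj δ • X.vertSub v ⊓ (N ⊓ X.PiG) : Subgroup X.PiH) : Set X.PiH) ≠ ⊥ →
            δ ∈ X.vertSub v ⊔ (N ⊓ X.PiG))
    (hinf : ∀ v : X.Vert, Infinite ↥(X.Iv v)) : X.Prop13v :=
  X.prop13v_of_psc_of_coverings G eV hV (hF0438 G hΩ).1 (hF0459 G hΩ).1 hgr hiii hiv' htf hcov hinf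

/-! ### The embedded datum and the constructed DPSC-extension `Π_𝒢 ⋊^out_θ J` -/

section Embedding

variable {P : Type u} [Group P] [TopologicalSpace P] [CompactSpace P]
  (G : PSCDatum P) (E : ProfiniteGrp.{u}) (ι : P →* E) (hιc : Continuous ι)
  (hιi : Function.Injective ι) (hιr : IsClosed (ι.range : Set E)) (hιn : ι.range.Normal)
  (PiI : Subgroup E) (hIn : PiI.Normal) (hle : ι.range ≤ PiI)

include hιc hιi

/-- **[AbsTopII] Prop 1.3 (v) (outer clauses) AS TYPED (F-0278) for the embedded datum**
(`DPSCData.ofEmbedding`: `Π_𝒢 ↪ E` closed normal, `Π_I ⊴ E`) from graphicity of the conjugation action,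
[CombGC] Prop 1.2 (i)(ii) for `G`, the typed rows `Prop13iii` / `Prop13iv'`, (iv) at the finite étale
coverings (Remark 1.2.1), "`I_v` torsion-free" and "`I_v` infinite" — the `hL` of `prop13v_ofEmbedding`
replaced. [cite: MochizukiAbsTopII2013, Prop 1.3 (v) p.12] [cite: MochizukiCombGC2007, Prop 1.2 p.8] -/
theorem prop13v_ofEmbedding_of_coverings
    (hconj : ∀ h : E, ∃ φ : P ≃ₜ* P, (∀ x, h * ι x * h⁻¹ = ι (φ x)) ∧ G.IsGraphic G φ)
    (hCT : G.VerticialEdgeLikeCommensurablyTerminal) (hDetV : G.VerticialOpenInterDeterminesVertex)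
    (hiii : (ofEmbedding G E ι hιr hιn PiI hIn hle).Prop13iii)
    (hiv' : (ofEmbedding G E ι hιr hιn PiI hIn hle).Prop13iv')
    (htf : ∀ (v : (ofEmbedding G E ι hιr hιn PiI hIn hle).Vert),
      ∀ x ∈ (ofEmbedding G E ι hιr hιn PiI hIn hle).Iv v, IsOfFinOrder x → x = 1)
    (hcov : ∀ N : Subgroup (ofEmbedding G E ι hιr hιn PiI hIn hle).PiH, N.Normal →
      IsOpen (N : Set (ofEmbedding G E ι hιr hιn PiI hIn hle).PiH) →
      ∃ J : Subgroup (ofEmbedding G E ι hιr hιn PiI hIn hle).PiH,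
        J ≤ N ⊓ (ofEmbedding G E ι hιr hιn PiI hIn hle).PiI ∧
        J.relIndex (ofEmbedding G E ι hιr hιn PiI hIn hle).PiI ≠ 0 ∧
        ∀ (v : (ofEmbedding G E ι hιr hιn PiI hIn hle).Vert),
          ∀ δ ∈ (ofEmbedding G E ι hιr hιn PiI hIn hle).PiG,
          Subgroup.centralizer (((ofEmbedding G E ι hιr hιn PiI hIn hle).vertSub v ⊓
              (N ⊓ (ofEmbedding G E ι hιr hιn PiI hIn hle).PiG) :
                Subgroup (ofEmbedding G E ι hιr hιn PiI hIn hle).PiH) :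
              Set (ofEmbedding G E ι hιr hιn PiI hIn hle).PiH) ⊓ J ⊓
            Subgroup.centralizer ((MulAut.conj δ • (ofEmbedding G E ι hιr hιn PiI hIn hle).vertSub v ⊓
              (N ⊓ (ofEmbedding G E ι hιr hιn PiI hIn hle).PiG) :
                Subgroup (ofEmbedding G E ι hιr hιn PiI hIn hle).PiH) :
              Set (ofEmbedding G E ι hιr hιn PiI hIn hle).PiH) ≠ ⊥ →
            δ ∈ (ofEmbedding G E ι hιr hιn PiI hIn hle).vertSub v ⊔
              (N ⊓ (ofEmbedding G E ι hιr hιn PiI hIn hle).PiG))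
    (hinf : ∀ v, Infinite ↥((ofEmbedding G E ι hιr hιn PiI hIn hle).Iv v)) :
    (ofEmbedding G E ι hιr hιn PiI hIn hle).Prop13v := by
  obtain ⟨e, he⟩ := exists_rangeEquiv G E ι hιr hιn PiI hIn hle hιc hιi
  exact prop13v_of_psc_of_coverings (ofEmbedding G E ι hιr hιn PiI hIn hle)
    (G.mapAlong e.toMulEquiv.toMonoidHom e.continuous G.Sigma subset_rfl G.sigma_nonempty
        (G.proSigma.of_continuousMulEquiv e))
    Equiv.ulift (vertSub_presentation G E ι hιr hιn PiI hIn hle he)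
    ((PSCDatum.verticialEdgeLikeCommensurablyTerminal_mapAlong_equiv_iff G e _ _ _ _).mpr hCT)
    ((PSCDatum.verticialOpenInterDeterminesVertex_mapAlong_equiv_iff G e _ _ _ _).mpr hDetV)
    (graphic_presentation G E ι hιr hιn PiI hIn hle he hconj) hiii hiv' htf hcov hinf

end Embedding

section OuterAction

variable {P : Type u} [Group P] [TopologicalSpace P] [IsTopologicalGroup P] [CompactSpace P]
  [TotallyDisconnectedSpace P] (G : PSCDatum P) (hG : IsTopologicallyFinitelyGenerated P)
  (hZ : Subgroup.center P = ⊥)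
  {J : Type u} [Group J] [TopologicalSpace J] [IsTopologicalGroup J] [CompactSpace J]
  [TotallyDisconnectedSpace J] (θ : J →ₜ* outProfinite hG) (I : Subgroup J) [I.Normal]

include hZ

/-- **[AbsTopII] Prop 1.3 (v) (outer clauses) AS TYPED (F-0278) for the CONSTRUCTED DPSC-extension
`Π_𝒢 ⋊^out_θ J`** (`DPSCData.ofOuterAction`, Def 1.2 (ii)) from: the `Aut`-component of every element is
graphic, [CombGC] Prop 1.2 (i)(ii) for `G`, the typed rows `Prop13iii` / `Prop13iv'`, (iv) at the finite
étale coverings (Remark 1.2.1), "`I_v` torsion-free" and "`I_v` infinite" — the `hL` of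
`prop13v_ofOuterAction` replaced. [cite: MochizukiAbsTopII2013, Prop 1.3 (v) p.12]
[cite: MochizukiCombGC2007, Prop 1.2 p.8] -/
theorem prop13v_ofOuterAction_of_coverings
    (hgraphic : ∀ h : outerSemidirectProfinite hG θ, G.IsGraphic G (conjAutOf hG θ h))
    (hCT : G.VerticialEdgeLikeCommensurablyTerminal) (hDetV : G.VerticialOpenInterDeterminesVertex)
    (hiii : (ofOuterAction G hG θ I).Prop13iii) (hiv' : (ofOuterAction G hG θ I).Prop13iv')
    (htf : ∀ (v : (ofOuterAction G hG θ I).Vert),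
      ∀ x ∈ (ofOuterAction G hG θ I).Iv v, IsOfFinOrder x → x = 1)
    (hcov : ∀ N : Subgroup (ofOuterAction G hG θ I).PiH, N.Normal →
      IsOpen (N : Set (ofOuterAction G hG θ I).PiH) →
      ∃ J' : Subgroup (ofOuterAction G hG θ I).PiH,
        J' ≤ N ⊓ (ofOuterAction G hG θ I).PiI ∧ J'.relIndex (ofOuterAction G hG θ I).PiI ≠ 0 ∧
        ∀ (v : (ofOuterAction G hG θ I).Vert), ∀ δ ∈ (ofOuterAction G hG θ I).PiG,
          Subgroup.centralizer (((ofOuterAction G hG θ I).vertSub v ⊓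
              (N ⊓ (ofOuterAction G hG θ I).PiG) : Subgroup (ofOuterAction G hG θ I).PiH) :
              Set (ofOuterAction G hG θ I).PiH) ⊓ J' ⊓
            Subgroup.centralizer ((MulAut.conj δ • (ofOuterAction G hG θ I).vertSub v ⊓
              (N ⊓ (ofOuterAction G hG θ I).PiG) : Subgroup (ofOuterAction G hG θ I).PiH) :
              Set (ofOuterAction G hG θ I).PiH) ≠ ⊥ →
            δ ∈ (ofOuterAction G hG θ I).vertSub v ⊔ (N ⊓ (ofOuterAction G hG θ I).PiG))
    (hinf : ∀ v, Infinite ↥((ofOuterAction G hG θ I).Iv v)) :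
    (ofOuterAction G hG θ I).Prop13v :=
  prop13v_ofEmbedding_of_coverings G _ _ (inlProfinite hG θ).continuous
    (inlProfinite_injective hG θ hZ) _ _ _ _ _ (hconj_ofOuterAction G hG θ hgraphic) hCT hDetV hiii hiv'
    htf hcov hinf

end OuterAction

end DPSCData

end Literature.AnabelianGeometry.AbsoluteAnabelian
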